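import Summits.QuantumFields.BalabanUV.T4Continuum.Support.NE7PairwiseCouplingDock

/-!
# NE7PairwiseCouplingUniform — row NE7 (node U5), route «PAIR-CAUCHY»: «arbitrary offset sequences = uniformity in the
# finer run», made a theorem — the dock's conclusion `couplingGap_tendsto_zero` (stated for an arbitrary offset sequence
# `n`) is upgraded to the ε-form UNIFORM over all finer runs `K′ ≥ K`, which is the form the pairwise exits
# (`NE7PairwiseCauchyWindow.pairCauchy_of_windowedHybrid`: remainder `vol·D w K` independent of `K′`) consume

Cell `pub-balaban`, rung (B)+1 sub-cell t4, lineage `b2b-balaban-t4-ne7-p2` (CRUX PROVER NE7 #2 under the coordinator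
ruling «YM redirect», 2026-08-21; generation 49; route text `HOME/t4/b2b-balaban-t4-ne7-p2/g49/ROUTE2-NE7-P2.md` v1.4
§2 T.5♭).  HONEST FRAMING (page 1): FIXED FINITE T⁴, rung (B)+1 = existence AND uniqueness of the `ε = L^{−K} → 0` limit
of unit-scale averaged expectations, CONDITIONAL on BetaPertH and the nine spine estimates (0/9 proved); NOT infinite
volume, NOT a mass gap, NOT the Clay problem.  NE7 is NOT PRINTED in [Balaban1984PropagatorsI]–[Balaban1989LargeFieldII]
and NOT proved here.  Everything below is [folklore] real analysis (a diagonal∕choice argument) over the tree's hypothesis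
SHAPES; no definition, no cite tag, nothing printed asserted, no `sorry`.

WHY.  `NE7PairwiseCouplingDock.couplingGap_tendsto_zero` concludes, for EVERY offset sequence `n : ℕ → ℕ`,
`∀ m, |1∕(g K (K−m))² − 1∕(g (K + n K) (K − m + n K))²| → 0`.  The pairwise exits of the route
(`NE7PairwiseCauchy.cauchySeq_genFun_of_pairMatching`, `NE7PairwiseCauchyWindow.pairCauchy_of_windowedHybrid`) consume
a remainder `D K` (resp. `vol·D w K`) bounding the pair `(K, K′)` for ALL `K′ ≥ K` at once.  The passage from «every
sequence» to «uniformly in `K′`» is the classical diagonal argument: if uniformity failed at some `ε`, choosing for each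
`K` a bad offset would produce a sequence along which the gap does not tend to zero (§1 `uniform_of_forall_seq`, choice
used).  §2 applies it to the dock: **`couplingGap_uniform`** — under the dock's binders VERBATIM, for every block scale `m`
and every `ε > 0` there is `K₀` such that for all `K₀ ≤ K ≤ K′`,
`|1∕(g K (K−m))² − 1∕(g K′ (K′−m))²| < ε` — the two-run coupling gap at fixed block scale below the unit lattice is
small for ALL pairs of sufficiently fine runs: the marginal input of leaf T.5♭ in exactly the pairwise-uniform form.

WHAT IS PROVED ([folklore]).
§1 `uniform_of_forall_seq` — `(∀ n : ℕ → ℕ, Tendsto (fun K => a K (n K)) atTop (𝓝 0)) → ∀ ε > 0, ∃ K₀, ∀ K ≥ K₀, ∀ n,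
   a K n < ε`.
§2 **`couplingGap_uniform`** (displayed above; offsets re-expressed as the finer run's length `K′ = K + n`, with
   `K − m + n = K′ − m` once `m ≤ K`).

NOT DELIVERED: anything beyond `NE7PairwiseCouplingDock`'s inputs (all UNPRINTED hypothesis shapes: (σ), `FadingMemory`,
`EventualLowerH`, `BetaUpperH`, the pins).  NOT NE7 (spine 0/9 unchanged), NOT summit progress.  HONEST DEPENDENCY:
continuum YM on T⁴ ⇐ BetaPertH ∧ nine spine estimates (0/9 proved); BetaPertH ⇐ (D1) ∧ (D4) ∧ CAP+tail; G-an2-4 gates asym,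
D1 and NE2/3/4.
-/

noncomputable section

open Finset Filter Topology
open scoped BigOperators

namespace Summit.QuantumFields.BalabanUV.T4Continuum.NE7PairwiseCouplingUniform

open Literature.MathematicalPhysics.QuantumFieldTheory.Balaban1983to89
open Literature.MathematicalPhysics.QuantumFieldTheory.Balaban1983to89.FlowStep
open Literature.MathematicalPhysics.QuantumFieldTheory.Balaban1983to89.T4CouplingMatching

/-! ## §1 Every sequence ⟹ uniformly (diagonal argument) -/

/-- **ARBITRARY SEQUENCES = UNIFORMITY.**  If `a K (n K) → 0` as `K → ∞` for EVERY offset sequence `n : ℕ → ℕ`, then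
`a K n` is small for large `K` UNIFORMLY in `n`: for every `ε > 0` there is `K₀` with `a K n < ε` for all `K ≥ K₀` and
all `n`.  (Contrapositive: pick, for each `K`, an offset where `ε ≤ a K n` if there is one; along that sequence the
hypothesis fails.  Choice is used.) [folklore] -/
theorem uniform_of_forall_seq {a : ℕ → ℕ → ℝ}
    (h : ∀ n : ℕ → ℕ, Tendsto (fun K => a K (n K)) atTop (𝓝 0)) :
    ∀ ε : ℝ, 0 < ε → ∃ K₀ : ℕ, ∀ K, K₀ ≤ K → ∀ n, a K n < ε := by
  intro ε hε
  by_contra hcon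
  push Not at hcon
  classical
  -- the diagonal offset sequence: a bad offset where one exists
  let n : ℕ → ℕ := fun K => if hK : ∃ j, ε ≤ a K j then Classical.choose hK else 0
  have hn : ∀ K, (∃ j, ε ≤ a K j) → ε ≤ a K (n K) := fun K hK => by
    simp only [n, dif_pos hK]
    exact Classical.choose_spec hK
  have ht := h n
  rw [Metric.tendsto_atTop] at ht
  obtain ⟨K₀, hK₀⟩ := ht ε hε
  obtain ⟨K, hK, j, hj⟩ := hcon K₀
  have h1 := hK₀ K hK
  rw [Real.dist_eq, sub_zero] at h1
  have h2 := hn K ⟨j, hj⟩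
  exact absurd (lt_of_le_of_lt h2 (lt_of_abs_lt h1)) (lt_irrefl _)

/-! ## §2 The coupling gap, uniformly over all finer runs -/

/-- **LEAF T.5♭, PAIRWISE-UNIFORM FORM.**  Under the binders of `NE7PairwiseCouplingDock.couplingGap_tendsto_zero`
VERBATIM (family of IR-pinned runs of (0.20) in the box; `HistLipschitz` + `FadingMemory`; `EventualLowerH`; `BetaUpperH`;
the null n-layer scale-shift modulus (σ); the AF-window): for every block scale `m` and every `ε > 0` there is `K₀` such
that for all runs `K₀ ≤ K ≤ K′`, `|1∕(g K (K−m))² − 1∕(g K′ (K′−m))²| < ε`.  This is the dock applied to every offset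
sequence (§1) with the offset rewritten as `K′ = K + n` (`K − m + n = K′ − m` for `m ≤ K`, which `K₀ ≥ m` ensures).
Bookkeeping over UNPRINTED inputs. [folklore] -/
theorem couplingGap_uniform {β : HBeta} {γ b β' C θ q gIR : ℝ} {k₀ : ℕ} {Λ : ℕ → ℕ → ℝ}
    {σ : ℕ → ℝ} (g : ℕ → ℕ → ℝ)
    (hγ : 0 < γ) (hb : 0 < b) (hθ0 : 0 ≤ θ) (hθ1 : θ < 1) (hC : 0 ≤ C) (hβ' : 0 ≤ β')
    (hrun : ∀ N, RGEqH N β (g N)) (hbox : ∀ N i, i ≤ N → 0 < g N i ∧ g N i ≤ γ)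
    (hpin : ∀ N, g N N = gIR)
    (hL : HistLipschitz Λ γ β) (hΛ : FadingMemory C θ Λ)
    (hlo : EventualLowerH b γ k₀ β) (hup : BetaUpperH β' γ β)
    (hσ : ∀ n k (w : ℕ → ℝ), (∀ i, i ≤ k + n → 0 < w i ∧ w i ≤ γ) →
      |β (k + n) (prefixOf w (k + n)) - β k (prefixOf (fun i => w (i + n)) k)| ≤ σ k)
    (hσ0 : Tendsto σ atTop (𝓝 0))
    (hq : C * ((((k₀ : ℝ) + 1) * γ ^ 3 + 2 * γ / b) / (1 - θ)) ≤ q) (hq1 : q < 1) :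
    ∀ m : ℕ, ∀ ε : ℝ, 0 < ε → ∃ K₀ : ℕ, ∀ K K' : ℕ, K₀ ≤ K → K ≤ K' →
      |1 / (g K (K - m)) ^ 2 - 1 / (g K' (K' - m)) ^ 2| < ε := by
  intro m ε hε
  -- the dock for every offset sequence, then §1
  have hseq : ∀ n : ℕ → ℕ, Tendsto
      (fun K => |1 / (g K (K - m)) ^ 2 - 1 / (g (K + n K) (K - m + n K)) ^ 2|) atTop (𝓝 0) := fun n =>
    NE7PairwiseCouplingDock.couplingGap_tendsto_zero g n hγ hb hθ0 hθ1 hC hβ' hrun hbox hpin hL hΛ hlo hup hσ hσ0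
      hq hq1 m
  obtain ⟨K₀, hK₀⟩ := uniform_of_forall_seq
    (a := fun K n => |1 / (g K (K - m)) ^ 2 - 1 / (g (K + n) (K - m + n)) ^ 2|) hseq ε hε
  refine ⟨max K₀ m, fun K K' hK hKK' => ?_⟩
  have hK0 : K₀ ≤ K := le_trans (le_max_left _ _) hK
  have hmK : m ≤ K := le_trans (le_max_right _ _) hK
  have h := hK₀ K hK0 (K' - K)
  have e1 : K + (K' - K) = K' := by omega
  have e2 : K - m + (K' - K) = K' - m := by omega
  rw [e1, e2] at h
  exact h

end Summit.QuantumFields.BalabanUV.T4Continuum.NE7PairwiseCouplingUniform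

end
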